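import Literature.NumberTheory.EllipticCurves.KleinFrickeLevelFive
import Literature.NumberTheory.EllipticCurves.KleinFrickeSevenCertificateB
import Literature.NumberTheory.EllipticCurves.KleinFrickeSevenCertificateKernel
import HarnessLib

/-!
# Klein–Fricke at level 7: a rational `7`-isogeny forces `j = (t² + 13t + 49)(t² + 5t + 1)³ / t`

Sibling of `KleinFrickeLevelsTwoThree.lean` and `KleinFrickeLevelFive.lean`, for the `provefact`
unit on `Literature.NumberTheory.EllipticCurves.kenku_minimalLevels_mem_kenkuDegrees` (Silverman,
*AEC* 2nd ed., Exercise 6.4; Kenku, J. Number Theory **15** (1982), Thm 1, case (c) at `N' = 7`).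
Fricke's parametrisation of `X₀(7)`: an elliptic curve over a field of characteristic `0` with
`j ≠ 0` and a rational cyclic `7`-isogeny has `j = (t² + 13t + 49)(t² + 5t + 1)³ / t` for a nonzero
rational `t` (Klein–Fricke, *Vorlesungen über die Theorie der elliptischen Modulfunktionen* II
(1892); Maier, arXiv:math/0611041, Table 4).

## The proof (elementary; one step by certified computation)

* `WeierstrassCurve.addX_add_addX_neg_mul_of_isShortNF`: `(x(P+Q) + x(P-Q))(x₁-x₂)² =
  2(x₁x₂+a)(x₁+x₂) + 4b` on `y² = x³ + ax + b` (Silverman III.2.3).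
* `WeierstrassCurve.Isogeny.exists_kernel_coords_of_degree_eq_seven`: for a degree-`7` isogeny with
  kernel generator `P`, the coordinates `x₁ = x(P)`, `x₂ = x(2P)`, `x₃ = x(3P)` satisfy two
  duplication relations and the chord relation, and `x₁+x₂+x₃`, `x₁x₂+x₁x₃+x₂x₃ ∈ K`: `Γ_K` maps
  `P ↦ kP` and then `(x₁, x₂, x₃) ↦ (x_k, x_{2k}, x_{3k})` is a CYCLIC permutation for every
  `k ∈ (ℤ/7)ˣ` (Silverman III.4.12-equivariance of the prelude `Isogeny`; descent by
  `InfiniteGalois.mem_range_algebraMap_iff_fixed`).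
* `Literature.NumberTheory.EllipticCurves.klein_seven_core`: with `s₁, s₂` the two symmetric
  functions, BOTH `T = (6a + 18s₂ - 4s₁²)/(s₁² - 3s₂)` and `T = (s₁² - 5s₂ - 18a)/(2(s₂ + a))` satisfy
  the cleared relation `6912a³·U·V⁷ = (4a³+27b²)(U²+13UV+49V²)(U²+5UV+V²)³`. The formulae were
  READ OFF from the Tate normal form `E_d : y² + (1+d-d²)xy + (d²-d³)y = x³ + (d²-d³)x²`
  (`7`-torsion point `(0,0)`), on which the Hauptmodul is `t = (d³-8d²+5d+1)/(d²-d)`; the proof is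
  by elimination of `x₂, x₃` (duplication and chord relations) and two polynomial identities
  `Γ₇ = q·Ψ₇` in `ℤ[a, b, x₁]` of degree `192` (`Ψ₇` = the primitive `7`-division polynomial,
  degree `24`; each `q` has 2605 monomials), too large for `ring` and therefore checked by the
  sparse-polynomial evaluator `PolyCert` (file `KleinFrickeSevenCertificate`) with `native_decide` (declared `computational`:
  the two certificate theorems `gamma7_cert`, `gamma7b_cert` depend on `Lean.ofReduceBool`), and
  — as now USED here — re-checked by the KERNEL in `KleinFrickeSevenCertificateKernel`
  (`eval_gamma7Of_eq_kernel`, `eval_gamma7bOf_eq_kernel`: Kronecker evaluation + balanced-digit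
  injectivity; axioms `propext, Classical.choice, Quot.sound` only), so that `klein_seven_core`
  and everything downstream is axiom-clean. The certificates were generated by exact polynomial division (pure Python,
  a few seconds) and are reproducible from the printed `U7, V7, U7b, V7b, Phi7`.
* `PolyCert` (in `KleinFrickeSevenCertificate`): sparse integer polynomials in three variables
  with PROVED evaluation lemmas; `eval_eq_of_isZero_sub` turns a successful normal-form check into
  an equality of values in any commutative ring. Only the Boolean check itself is run natively;
  the data and the two certificates live in `KleinFrickeSevenCertificate(B)` (size limits).
* The hole `V = 0` of one formula forces `U = 0` (from its identity), and both holes together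
  force `a = 0`, i.e. `j = 0` — excluded by hypothesis (and irrelevant for Kenku's tables); at
  `j = 0` the formulae are genuinely `0/0` (the CM `7`-isogenies of `y² = x³ + b`).
* `WeierstrassCurve.Isogeny.exists_j_eq_klein_seven_of_degree_eq_seven`: the theorem, after
  reduction to short normal form (`exists_variableChange_isShortNF`,
  `Isogeny.exists_degree_eq_of_variableChange`, `variableChange_j`, `j_of_isShortNF`).
-/

noncomputable section

open scoped Classical

universe u

namespace WeierstrassCurve

variable {F : Type*} [Field F]

/-- **`x(P+Q) + x(P-Q)` on a short Weierstrass curve** `y² = x³ + ax + b`: for affine points with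
`x₁ ≠ x₂`, `(x(P+Q) + x(P-Q))·(x₁ - x₂)² = 2(x₁x₂ + a)(x₁ + x₂) + 4b` (from the chord formula
`x(P±Q) = λ±² - x₁ - x₂`, `λ± = (y₁ ∓ y₂)/(x₁ - x₂)`, Silverman III.2.3). [cite: SilvermanAEC2009,
III.2.3] -/
theorem addX_add_addX_neg_mul_of_isShortNF (V : WeierstrassCurve F) [V.IsShortNF] {x₁ y₁ x₂ y₂ : F}
    (h₁ : V.toAffine.Nonsingular x₁ y₁) (h₂ : V.toAffine.Nonsingular x₂ y₂) (hx : x₁ ≠ x₂) :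
    (V.toAffine.addX x₁ x₂ (V.toAffine.slope x₁ x₂ y₁ y₂) +
        V.toAffine.addX x₁ x₂ (V.toAffine.slope x₁ x₂ y₁ (V.toAffine.negY x₂ y₂))) * (x₁ - x₂) ^ 2 =
      2 * (x₁ * x₂ + V.a₄) * (x₁ + x₂) + 4 * V.a₆ := by
  have ha₁ : V.a₁ = 0 := IsShortNF.a₁
  have ha₂ : V.a₂ = 0 := IsShortNF.a₂
  have ha₃ : V.a₃ = 0 := IsShortNF.a₃
  have e₁ := (Affine.equation_iff ..).mp h₁.1
  have e₂ := (Affine.equation_iff ..).mp h₂.1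
  rw [Affine.slope_of_X_ne hx, Affine.slope_of_X_ne hx]
  have hd : x₁ - x₂ ≠ 0 := sub_ne_zero.mpr hx
  simp only [Affine.negY, Affine.addX, ha₁, ha₂, ha₃, zero_mul, sub_zero, add_zero] at e₁ e₂ ⊢
  field_simp
  linear_combination 2 * e₁ + 2 * e₂

end WeierstrassCurve

namespace WeierstrassCurve

namespace Isogeny

open Literature.NumberTheory.EllipticCurves Polynomial

variable {K : Type u} [Field K] [CharZero K] {V V' : WeierstrassCurve K}

set_option maxHeartbeats 1600000 in
/-- **Kernel coordinates of a degree-`7` isogeny on a short Weierstrass curve.** If `φ : V → V'`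
has degree `7` (`V : y² = x³ + ax + b`, characteristic `0`) and `P` generates `ker φ`, then with
`x₁ = x(P)`, `x₂ = x(2P)`, `x₃ = x(3P)`: the symmetric functions `x₁ + x₂ + x₃` and
`x₁x₂ + x₁x₃ + x₂x₃` are in `K` (`Γ_K` permutes `ker φ ∖ {O}` and induces a cyclic permutation of
`(x₁, x₂, x₃)`), `x₁ ≠ x₂`, `f(x₁) ≠ 0`, `f(x₂) ≠ 0`, and the three relations
`4f(x₁)x₂ = N(x₁)` (`2·P`), `4f(x₂)x₃ = N(x₂)` (`2·2P = 4P = -3P`), and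
`x₃(x₁-x₂)² = 2(x₁x₂+a)(x₁+x₂) + 4b - x₁(x₁-x₂)²` (`x(P+2P) + x(P-2P)`, `P - 2P = -P`).
[cite: SilvermanAEC2009, III.2.3, III.4.12] -/
theorem exists_kernel_coords_of_degree_eq_seven [V.IsShortNF] (φ : Isogeny V V')
    (hdeg : φ.degree = 7) :
    ∃ (x₁ x₂ x₃ : AlgebraicClosure K) (s₀ p₀ : K),
      algebraMap K (AlgebraicClosure K) s₀ = x₁ + x₂ + x₃ ∧
      algebraMap K (AlgebraicClosure K) p₀ = x₁ * x₂ + x₁ * x₃ + x₂ * x₃ ∧ x₁ ≠ x₂ ∧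
      x₁ ^ 3 + algebraMap K _ V.a₄ * x₁ + algebraMap K _ V.a₆ ≠ 0 ∧
      x₂ ^ 3 + algebraMap K _ V.a₄ * x₂ + algebraMap K _ V.a₆ ≠ 0 ∧
      4 * (x₁ ^ 3 + algebraMap K _ V.a₄ * x₁ + algebraMap K _ V.a₆) * x₂ =
        x₁ ^ 4 - 2 * algebraMap K _ V.a₄ * x₁ ^ 2 - 8 * algebraMap K _ V.a₆ * x₁ +
          algebraMap K _ V.a₄ ^ 2 ∧
      4 * (x₂ ^ 3 + algebraMap K _ V.a₄ * x₂ + algebraMap K _ V.a₆) * x₃ =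
        x₂ ^ 4 - 2 * algebraMap K _ V.a₄ * x₂ ^ 2 - 8 * algebraMap K _ V.a₆ * x₂ +
          algebraMap K _ V.a₄ ^ 2 ∧
      x₃ * (x₁ - x₂) ^ 2 =
        2 * (x₁ * x₂ + algebraMap K _ V.a₄) * (x₁ + x₂) + 4 * algebraMap K _ V.a₆ -
          x₁ * (x₁ - x₂) ^ 2 := by
  haveI : IsGalois K (AlgebraicClosure K) := {}
  set Vb := V.baseChange (AlgebraicClosure K) with hVb
  have hba₁ : Vb.a₁ = 0 := by simp [hVb]
  have hba₂ : Vb.a₂ = 0 := by simp [hVb]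
  have hba₃ : Vb.a₃ = 0 := by simp [hVb]
  haveI : Vb.IsShortNF := ⟨hba₁, hba₂, hba₃⟩
  have hba₄ : Vb.a₄ = algebraMap K _ V.a₄ := rfl
  have hba₆ : Vb.a₆ = algebraMap K _ V.a₆ := rfl
  -- a nonzero kernel point `P`, of order `7`
  set A := φ.toAddMonoidHom.ker with hA
  haveI : Finite A := φ.finite_ker'
  have hnt : 1 < Nat.card A := by rw [show Nat.card A = 7 from hdeg]; norm_num
  obtain ⟨P, hP0⟩ : ∃ P : A, P ≠ 0 :=
    haveI := Finite.one_lt_card_iff_nontrivial.mp hnt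
    exists_ne 0
  have hord : addOrderOf P = 7 := by
    have hdvd : addOrderOf P ∣ 7 := hdeg ▸ addOrderOf_dvd_natCard P
    rcases (Nat.dvd_prime (by norm_num : Nat.Prime 7)).mp hdvd with h1 | h7
    · exact absurd (AddMonoid.addOrderOf_eq_one_iff.mp h1) hP0
    · exact h7
  have hmul : ∀ k : ℕ, k • (P : V.geomPoints) = 0 → 7 ∣ k := by
    intro k hk
    have hk' : k • P = 0 := Subtype.ext (by rw [AddSubmonoidClass.coe_nsmul]; exact hk)
    exact hord ▸ addOrderOf_dvd_of_nsmul_eq_zero hk'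
  have h7P : (7 : ℕ) • (P : V.geomPoints) = 0 := by
    have := addOrderOf_nsmul_eq_zero P
    rw [hord] at this
    exact_mod_cast congrArg Subtype.val this
  have hPne : (P : V.geomPoints) ≠ 0 := fun h ↦ hP0 (Subtype.ext h)
  have hkP : ∀ k : ℕ, 0 < k → k < 7 → k • (P : V.geomPoints) ≠ 0 := fun k hk hk7 h ↦ by
    have := Nat.le_of_dvd hk (hmul k h); omega
  -- coordinates of `P`
  obtain ⟨P₀, hP₀A⟩ := P
  simp only at hPne hkP h7P hmul
  change Vb.toAffine.Point at P₀
  rcases P₀ with _ | ⟨x₁, y₁, h₁⟩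
  · exact (hPne rfl).elim
  set P₀ : V.geomPoints := (Affine.Point.some x₁ y₁ h₁ : Vb.toAffine.Point) with hP₀def
  -- reduction of multiples mod 7
  have hmod : ∀ m : ℕ, m • P₀ = (m % 7) • P₀ := fun m ↦ by
    conv_lhs => rw [← Nat.mod_add_div m 7, add_nsmul, mul_nsmul, h7P, nsmul_zero, add_zero]
  have h2P := hkP 2 (by norm_num) (by norm_num)
  have h3P := hkP 3 (by norm_num) (by norm_num)
  have h4P := hkP 4 (by norm_num) (by norm_num)
  have h6P := hkP 6 (by norm_num) (by norm_num)
  -- negatives: `(7 - k) • P = -(k • P)`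
  have hneg : ∀ k : ℕ, k ≤ 7 → (7 - k) • P₀ = -(k • P₀) := fun k hk ↦ by
    rw [eq_neg_iff_add_eq_zero, ← add_nsmul, Nat.sub_add_cancel hk, h7P]
  -- `P` is not `2`-torsion
  have hy₁ : y₁ ≠ Vb.toAffine.negY x₁ y₁ := by
    intro hy
    apply h2P
    rw [two_nsmul]
    change (Affine.Point.some x₁ y₁ h₁ : Vb.toAffine.Point) + Affine.Point.some x₁ y₁ h₁ = 0
    have hn : -(Affine.Point.some x₁ y₁ h₁ : Vb.toAffine.Point) = Affine.Point.some x₁ y₁ h₁ := by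
      rw [Affine.Point.neg_some]; simp only [Affine.Point.some.injEq, true_and]; exact hy.symm
    nth_rewrite 2 [← hn]
    exact add_neg_cancel _
  -- `Q₂ = 2P`
  set x₂ := Vb.toAffine.addX x₁ x₁ (Vb.toAffine.slope x₁ x₁ y₁ y₁) with hx₂def
  set y₂ := Vb.toAffine.addY x₁ x₁ y₁ (Vb.toAffine.slope x₁ x₁ y₁ y₁) with hy₂def
  have h₂ : Vb.toAffine.Nonsingular x₂ y₂ := Affine.nonsingular_add h₁ h₁ fun hxy => hy₁ hxy.right
  have hQ₂ : (2 : ℕ) • P₀ = (Affine.Point.some x₂ y₂ h₂ : Vb.toAffine.Point) := by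
    rw [two_nsmul]; exact Affine.Point.add_self_of_Y_ne hy₁
  have hR1 := Vb.addX_self_mul_of_isShortNF h₁ hy₁
  rw [← hx₂def] at hR1
  -- `x₁ ≠ x₂`
  have heq₁ := (Affine.equation_iff ..).mp h₁.1
  have heq₂ := (Affine.equation_iff ..).mp h₂.1
  have hy₁' := hy₁
  simp only [Affine.negY, hba₁, hba₂, hba₃, zero_mul, sub_zero, add_zero] at hy₁' heq₁ heq₂
  have hf₁ : x₁ ^ 3 + Vb.a₄ * x₁ + Vb.a₆ ≠ 0 := by
    rw [← heq₁]; exact pow_ne_zero 2 fun h ↦ hy₁' (by rw [h, neg_zero])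
  have hx₁₂ : x₁ ≠ x₂ := by
    intro hx
    have hyy : (y₂ - y₁) * (y₂ + y₁) = 0 := by
      have : y₂ ^ 2 = y₁ ^ 2 := by rw [heq₁, heq₂, hx]
      linear_combination this
    rcases mul_eq_zero.mp hyy with hy | hy
    · apply hPne
      have e : (2 : ℕ) • P₀ = P₀ := by
        rw [hQ₂]
        change (Affine.Point.some x₂ y₂ h₂ : Vb.toAffine.Point) = Affine.Point.some x₁ y₁ h₁
        simp only [Affine.Point.some.injEq]
        exact ⟨hx.symm, sub_eq_zero.mp hy⟩
      have := congrArg (· - P₀) e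
      simpa [two_nsmul] using this
    · apply h3P
      have e : (2 : ℕ) • P₀ = -P₀ := by
        rw [hQ₂]
        change (Affine.Point.some x₂ y₂ h₂ : Vb.toAffine.Point) = -Affine.Point.some x₁ y₁ h₁
        rw [Affine.Point.neg_some]
        simp only [Affine.Point.some.injEq, Affine.negY, hba₁, hba₃, zero_mul, sub_zero]
        exact ⟨hx.symm, eq_neg_of_add_eq_zero_left hy⟩
      rw [show (3 : ℕ) = 2 + 1 from rfl, add_nsmul, one_nsmul, e, neg_add_cancel]
  -- `Q₃ = 3P = P + 2P`
  set x₃ := Vb.toAffine.addX x₁ x₂ (Vb.toAffine.slope x₁ x₂ y₁ y₂) with hx₃def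
  set y₃ := Vb.toAffine.addY x₁ x₂ y₁ (Vb.toAffine.slope x₁ x₂ y₁ y₂) with hy₃def
  have h₃ : Vb.toAffine.Nonsingular x₃ y₃ := Affine.nonsingular_add h₁ h₂ fun hxy => hx₁₂ hxy.1
  have hQ₃ : (3 : ℕ) • P₀ = (Affine.Point.some x₃ y₃ h₃ : Vb.toAffine.Point) := by
    rw [show (3 : ℕ) = 1 + 2 from rfl, add_nsmul, one_nsmul, hQ₂]
    exact Affine.Point.add_of_X_ne hx₁₂
  -- `4P = -3P`, `5P = -2P`, `6P = -P`
  have h4 : (4 : ℕ) • P₀ = -(Affine.Point.some x₃ y₃ h₃ : Vb.toAffine.Point) := by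
    rw [← hQ₃]; exact hneg 3 (by norm_num)
  have h5 : (5 : ℕ) • P₀ = -(Affine.Point.some x₂ y₂ h₂ : Vb.toAffine.Point) := by
    rw [← hQ₂]; exact hneg 2 (by norm_num)
  have h6 : (6 : ℕ) • P₀ = -(Affine.Point.some x₁ y₁ h₁ : Vb.toAffine.Point) := hneg 1 (by norm_num)
  -- `R2`: doubling `2P ↦ 4P = -3P`
  have hy₂ : y₂ ≠ Vb.toAffine.negY x₂ y₂ := by
    intro hy
    apply h4P
    have e : (4 : ℕ) • P₀ = (2 : ℕ) • P₀ + (2 : ℕ) • P₀ := by rw [← add_nsmul]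
    rw [e, hQ₂]
    have hn : -(Affine.Point.some x₂ y₂ h₂ : Vb.toAffine.Point) = Affine.Point.some x₂ y₂ h₂ := by
      rw [Affine.Point.neg_some]; simp only [Affine.Point.some.injEq, true_and]; exact hy.symm
    nth_rewrite 2 [← hn]
    exact add_neg_cancel _
  have hR2 : x₃ * (4 * (x₂ ^ 3 + Vb.a₄ * x₂ + Vb.a₆)) =
      x₂ ^ 4 - 2 * Vb.a₄ * x₂ ^ 2 - 8 * Vb.a₆ * x₂ + Vb.a₄ ^ 2 := by
    have hdup := Vb.addX_self_mul_of_isShortNF h₂ hy₂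
    have e : ((Affine.Point.some x₂ y₂ h₂ : Vb.toAffine.Point) +
        (Affine.Point.some x₂ y₂ h₂ : Vb.toAffine.Point) : Vb.toAffine.Point) =
        -Affine.Point.some x₃ y₃ h₃ := by
      have e1 : (4 : ℕ) • P₀ = (2 : ℕ) • P₀ + (2 : ℕ) • P₀ := by rw [← add_nsmul]
      rw [hQ₂] at e1
      exact e1.symm.trans h4
    have hx : Vb.toAffine.addX x₂ x₂ (Vb.toAffine.slope x₂ x₂ y₂ y₂) = x₃ := by
      rw [Affine.Point.add_self_of_Y_ne hy₂, Affine.Point.neg_some] at e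
      simp only [Affine.Point.some.injEq] at e
      exact e.1
    rwa [hx] at hdup
  have hy₂' := hy₂
  simp only [Affine.negY, hba₁, hba₃, zero_mul, sub_zero] at hy₂'
  have hf₂ : x₂ ^ 3 + Vb.a₄ * x₂ + Vb.a₆ ≠ 0 := by
    rw [← heq₂]; exact pow_ne_zero 2 fun h ↦ hy₂' (by rw [h, neg_zero])
  -- `R3`: `x(P + 2P) + x(P - 2P) = x₃ + x₁`
  have hR3 : x₃ * (x₁ - x₂) ^ 2 =
      2 * (x₁ * x₂ + Vb.a₄) * (x₁ + x₂) + 4 * Vb.a₆ - x₁ * (x₁ - x₂) ^ 2 := by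
    have hsum := Vb.addX_add_addX_neg_mul_of_isShortNF h₁ h₂ hx₁₂
    -- `P + (-2P) = -P`, so the second `addX` is `x₁`
    have e : ((Affine.Point.some x₁ y₁ h₁ : Vb.toAffine.Point) +
        (-(Affine.Point.some x₂ y₂ h₂ : Vb.toAffine.Point)) : Vb.toAffine.Point) =
        -Affine.Point.some x₁ y₁ h₁ := by
      have e1 : P₀ + (5 : ℕ) • P₀ = (6 : ℕ) • P₀ := by
        rw [show (6 : ℕ) = 1 + 5 from rfl, add_nsmul, one_nsmul]
      rw [h5, h6] at e1
      exact e1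
    have hx : Vb.toAffine.addX x₁ x₂ (Vb.toAffine.slope x₁ x₂ y₁ (Vb.toAffine.negY x₂ y₂)) = x₁ := by
      rw [Affine.Point.neg_some, Affine.Point.add_of_X_ne hx₁₂, Affine.Point.neg_some] at e
      simp only [Affine.Point.some.injEq] at e
      exact e.1
    rw [hx, ← hx₃def] at hsum
    linear_combination hsum
  -- Galois: `σ` permutes `(x₁, x₂, x₃)` cyclically
  have hset : ∀ R ∈ (A : Set V.geomPoints), ∃ k : ℕ, k < 7 ∧ R = k • P₀ := by
    have hsub : (Finset.image (fun k : Fin 7 ↦ (k : ℕ) • P₀) Finset.univ : Set V.geomPoints) ⊆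
        (A : Set V.geomPoints) := by
      intro R hR
      simp only [Finset.coe_image, Finset.coe_univ, Set.image_univ, Set.mem_range] at hR
      obtain ⟨k, rfl⟩ := hR
      exact A.nsmul_mem hP₀A _
    have hinj : Function.Injective fun k : Fin 7 ↦ (k : ℕ) • P₀ := by
      intro i j hij
      simp only at hij
      ext
      by_contra hne
      rcases Nat.lt_or_gt_of_ne hne with hlt | hlt
      · have h0 : ((j : ℕ) - i) • P₀ = 0 := by
          have : ((j : ℕ) - i) • P₀ + (i : ℕ) • P₀ = (j : ℕ) • P₀ := by
            rw [← add_nsmul, Nat.sub_add_cancel hlt.le]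
          rw [hij] at this
          simpa using this
        exact hkP _ (by omega) (by omega) h0
      · have h0 : ((i : ℕ) - j) • P₀ = 0 := by
          have : ((i : ℕ) - j) • P₀ + (j : ℕ) • P₀ = (i : ℕ) • P₀ := by
            rw [← add_nsmul, Nat.sub_add_cancel hlt.le]
          rw [← hij] at this
          simpa using this
        exact hkP _ (by omega) (by omega) h0
    have hcard : (Finset.image (fun k : Fin 7 ↦ (k : ℕ) • P₀) Finset.univ).card = 7 := by
      rw [Finset.card_image_of_injective _ hinj]; simp
    have heqset : (Finset.image (fun k : Fin 7 ↦ (k : ℕ) • P₀) Finset.univ : Set V.geomPoints) =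
        (A : Set V.geomPoints) := by
      apply Set.eq_of_subset_of_ncard_le hsub
      · rw [← Nat.card_coe_set_eq (A : Set V.geomPoints), SetLike.coe_sort_coe,
          show Nat.card A = 7 from hdeg, Set.ncard_coe_finset, hcard]
    intro R hR
    rw [← heqset] at hR
    simp only [Finset.coe_image, Finset.coe_univ, Set.image_univ, Set.mem_range] at hR
    obtain ⟨k, rfl⟩ := hR
    exact ⟨k, k.isLt, rfl⟩
  have hfix : ∀ σ : AlgebraicClosure K ≃ₐ[K] AlgebraicClosure K,
      σ (x₁ + x₂ + x₃) = x₁ + x₂ + x₃ ∧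
        σ (x₁ * x₂ + x₁ * x₃ + x₂ * x₃) = x₁ * x₂ + x₁ * x₃ + x₂ * x₃ := by
    intro σ
    set τ : Field.absoluteGaloisGroup K := σ with hτ
    have hτP : τ • P₀ ∈ (A : Set V.geomPoints) := by
      change τ • P₀ ∈ φ.toAddMonoidHom.ker
      rw [AddMonoidHom.mem_ker, coe_toAddMonoidHom, φ.map_smul,
        show φ P₀ = 0 from (AddMonoidHom.mem_ker).mp hP₀A, smul_zero]
    have hτn : ∀ n : ℕ, τ • (n • P₀) = n • (τ • P₀) := fun n ↦
      map_nsmul (DistribSMul.toAddMonoidHom V.geomPoints τ) n P₀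
    obtain ⟨k, hk7, hk⟩ := hset _ hτP
    -- the images of `P, 2P, 3P` are `kP, 2kP, 3kP`
    have i1 : τ • P₀ = (k % 7) • P₀ := by rw [hk, ← hmod]
    have i2 : τ • ((2 : ℕ) • P₀) = (2 * k % 7) • P₀ := by rw [hτn, hk, ← mul_nsmul', hmod]
    have i3 : τ • ((3 : ℕ) • P₀) = (3 * k % 7) • P₀ := by rw [hτn, hk, ← mul_nsmul', hmod]
    rw [hQ₂] at i2
    rw [hQ₃] at i3
    have P1 : (1 : ℕ) • P₀ = (Affine.Point.some x₁ y₁ h₁ : Vb.toAffine.Point) := one_nsmul _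
    interval_cases k
    · exact (hPne (by simpa using congrArg (τ⁻¹ • ·) i1)).elim
    · -- k = 1 : identity
      simp only [Nat.reduceMod, Nat.reduceMul] at i1 i2 i3
      rw [P1] at i1; rw [hQ₂] at i2; rw [hQ₃] at i3
      have e1 := galois_x_eq_of_smul_eq i1
      have e2 := galois_x_eq_of_smul_eq i2
      have e3 := galois_x_eq_of_smul_eq i3
      exact ⟨by rw [map_add, map_add, e1, e2, e3], by
        rw [map_add, map_add, map_mul, map_mul, map_mul, e1, e2, e3]⟩
    · -- k = 2 : (x₂, x₃, x₁)   [2P, 4P = -3P, 6P = -P]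
      simp only [Nat.reduceMod, Nat.reduceMul] at i1 i2 i3
      rw [hQ₂] at i1; rw [h4] at i2; rw [h6] at i3
      have e1 := galois_x_eq_of_smul_eq i1
      have e2 := galois_x_eq_of_smul_eq_neg i2
      have e3 := galois_x_eq_of_smul_eq_neg i3
      exact ⟨by rw [map_add, map_add, e1, e2, e3]; ring, by
        rw [map_add, map_add, map_mul, map_mul, map_mul, e1, e2, e3]; ring⟩
    · -- k = 3 : (x₃, x₁, x₂)   [3P, 6P = -P, 9P = 2P]
      simp only [Nat.reduceMod, Nat.reduceMul] at i1 i2 i3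
      rw [hQ₃] at i1; rw [h6] at i2; rw [hQ₂] at i3
      have e1 := galois_x_eq_of_smul_eq i1
      have e2 := galois_x_eq_of_smul_eq_neg i2
      have e3 := galois_x_eq_of_smul_eq i3
      exact ⟨by rw [map_add, map_add, e1, e2, e3]; ring, by
        rw [map_add, map_add, map_mul, map_mul, map_mul, e1, e2, e3]; ring⟩
    · -- k = 4 : (x₃, x₁, x₂)   [4P = -3P, 8P = P, 12P = 5P = -2P]
      simp only [Nat.reduceMod, Nat.reduceMul] at i1 i2 i3
      rw [h4] at i1; rw [P1] at i2; rw [h5] at i3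
      have e1 := galois_x_eq_of_smul_eq_neg i1
      have e2 := galois_x_eq_of_smul_eq i2
      have e3 := galois_x_eq_of_smul_eq_neg i3
      exact ⟨by rw [map_add, map_add, e1, e2, e3]; ring, by
        rw [map_add, map_add, map_mul, map_mul, map_mul, e1, e2, e3]; ring⟩
    · -- k = 5 : (x₂, x₃, x₁)   [5P = -2P, 10P = 3P, 15P = P]
      simp only [Nat.reduceMod, Nat.reduceMul] at i1 i2 i3
      rw [h5] at i1; rw [hQ₃] at i2; rw [P1] at i3
      have e1 := galois_x_eq_of_smul_eq_neg i1
      have e2 := galois_x_eq_of_smul_eq i2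
      have e3 := galois_x_eq_of_smul_eq i3
      exact ⟨by rw [map_add, map_add, e1, e2, e3]; ring, by
        rw [map_add, map_add, map_mul, map_mul, map_mul, e1, e2, e3]; ring⟩
    · -- k = 6 : (x₁, x₂, x₃)   [6P = -P, 12P = 5P = -2P, 18P = 4P = -3P]
      simp only [Nat.reduceMod, Nat.reduceMul] at i1 i2 i3
      rw [h6] at i1; rw [h5] at i2; rw [h4] at i3
      have e1 := galois_x_eq_of_smul_eq_neg i1
      have e2 := galois_x_eq_of_smul_eq_neg i2
      have e3 := galois_x_eq_of_smul_eq_neg i3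
      exact ⟨by rw [map_add, map_add, e1, e2, e3], by
        rw [map_add, map_add, map_mul, map_mul, map_mul, e1, e2, e3]⟩
  -- descent and conclusion
  obtain ⟨s₀, hs₀⟩ := (InfiniteGalois.mem_range_algebraMap_iff_fixed (x₁ + x₂ + x₃)).mpr
    fun σ ↦ (hfix σ).1
  obtain ⟨p₀, hp₀⟩ :=
    (InfiniteGalois.mem_range_algebraMap_iff_fixed (x₁ * x₂ + x₁ * x₃ + x₂ * x₃)).mpr
      fun σ ↦ (hfix σ).2
  refine ⟨x₁, x₂, x₃, s₀, p₀, hs₀, hp₀, hx₁₂, hf₁, hf₂, ?_, ?_, ?_⟩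
  · rw [hba₄, hba₆] at hR1; linear_combination hR1
  · rw [hba₄, hba₆] at hR2; linear_combination hR2
  · rw [hba₄, hba₆] at hR3; linear_combination hR3

end Isogeny

end WeierstrassCurve

namespace Literature.NumberTheory.EllipticCurves

open PolyCert

set_option maxHeartbeats 4000000 in
/-- **The algebraic core of Klein–Fricke at level `7`** (short Weierstrass form, characteristic `0`).
With `x₁ = x(P)`, `x₂ = x(2P)`, `x₃ = x(3P)` for a point `P` of exact order `7` — encoded by the
duplication relations `4f(x₁)x₂ = N(x₁)`, `4f(x₂)x₃ = N(x₂)` and the chord relation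
`x₃(x₁-x₂)² = 2(x₁x₂+a)(x₁+x₂)+4b-x₁(x₁-x₂)²` — and `s₁ = x₁+x₂+x₃`, `s₂ = x₁x₂+x₁x₃+x₂x₃`, BOTH
pairs `(U, V) = (6a + 18s₂ - 4s₁², s₁² - 3s₂)` and `(U, V) = (s₁² - 5s₂ - 18a, 2(s₂ + a))` satisfy the
cleared Fricke relation `6912a³·U·V⁷ = (4a³+27b²)(U²+13UV+49V²)(U²+5UV+V²)³`, i.e.
`j·T = (T²+13T+49)(T²+5T+1)³`, `T = U/V`. The two formulae for the Hauptmodul `T` of `X₀(7)` were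
read off from the Tate normal form `E_d` (`7`-torsion point `(0,0)`), on which
`t = (d³-8d²+5d+1)/(d²-d)`; the proof eliminates `x₂, x₃` and checks two polynomial identities
`Γ₇ = q·Ψ₇` of degree `192` (`q`: 2605 monomials), certified by the kernel
(`KleinFrickeSevenCertificateKernel`). [cite: SilvermanAEC2009, III.2.3(d)] -/
theorem klein_seven_core {L : Type*} [Field L] [CharZero L] {a b x₁ x₂ x₃ : L}
    (hf₁ : x₁ ^ 3 + a * x₁ + b ≠ 0) (hx : x₁ ≠ x₂)
    (hR1 : 4 * (x₁ ^ 3 + a * x₁ + b) * x₂ = x₁ ^ 4 - 2 * a * x₁ ^ 2 - 8 * b * x₁ + a ^ 2)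
    (hR2 : 4 * (x₂ ^ 3 + a * x₂ + b) * x₃ = x₂ ^ 4 - 2 * a * x₂ ^ 2 - 8 * b * x₂ + a ^ 2)
    (hR3 : x₃ * (x₁ - x₂) ^ 2 = 2 * (x₁ * x₂ + a) * (x₁ + x₂) + 4 * b - x₁ * (x₁ - x₂) ^ 2) :
    ∀ s₁ s₂ : L, s₁ = x₁ + x₂ + x₃ → s₂ = x₁ * x₂ + x₁ * x₃ + x₂ * x₃ →
      6912 * a ^ 3 * (6 * a + 18 * s₂ - 4 * s₁ ^ 2) * (s₁ ^ 2 - 3 * s₂) ^ 7 =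
          (4 * a ^ 3 + 27 * b ^ 2) *
            ((6 * a + 18 * s₂ - 4 * s₁ ^ 2) ^ 2 +
                13 * ((6 * a + 18 * s₂ - 4 * s₁ ^ 2) * (s₁ ^ 2 - 3 * s₂)) +
                  49 * (s₁ ^ 2 - 3 * s₂) ^ 2) *
              ((6 * a + 18 * s₂ - 4 * s₁ ^ 2) ^ 2 +
                  5 * ((6 * a + 18 * s₂ - 4 * s₁ ^ 2) * (s₁ ^ 2 - 3 * s₂)) +
                    (s₁ ^ 2 - 3 * s₂) ^ 2) ^ 3 ∧
        6912 * a ^ 3 * (s₁ ^ 2 - 5 * s₂ - 18 * a) * (2 * (s₂ + a)) ^ 7 =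
          (4 * a ^ 3 + 27 * b ^ 2) *
            ((s₁ ^ 2 - 5 * s₂ - 18 * a) ^ 2 + 13 * ((s₁ ^ 2 - 5 * s₂ - 18 * a) * (2 * (s₂ + a))) +
                  49 * (2 * (s₂ + a)) ^ 2) *
              ((s₁ ^ 2 - 5 * s₂ - 18 * a) ^ 2 + 5 * ((s₁ ^ 2 - 5 * s₂ - 18 * a) * (2 * (s₂ + a))) +
                  (2 * (s₂ + a)) ^ 2) ^ 3 := by
  intro s₁ s₂ hs₁ hs₂
  have hF : (4 * (x₁ ^ 3 + a * x₁ + b)) ≠ 0 := mul_ne_zero (by norm_num) hf₁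
  have hΨ3 : (3 * x₁ ^ 4 + 6 * a * x₁ ^ 2 + 12 * b * x₁ - a ^ 2) ≠ 0 := by
    have e : (3 * x₁ ^ 4 + 6 * a * x₁ ^ 2 + 12 * b * x₁ - a ^ 2) = (4 * (x₁ ^ 3 + a * x₁ + b)) * (x₁ - x₂) := by linear_combination hR1
    rw [e]; exact mul_ne_zero hF (sub_ne_zero.mpr hx)
  -- the chord relation cleared: `Ψ₃(x₁)² x₃ = M(x₁)`
  have hR3' : ((3 * x₁ ^ 4 + 6 * a * x₁ ^ 2 + 12 * b * x₁ - a ^ 2) ^ 2 * x₃) = (2 * (x₁ * (x₁ ^ 4 - 2 * a * x₁ ^ 2 - 8 * b * x₁ + a ^ 2) + a * (4 * (x₁ ^ 3 + a * x₁ + b))) * ((4 * (x₁ ^ 3 + a * x₁ + b)) * x₁ + (x₁ ^ 4 - 2 * a * x₁ ^ 2 - 8 * b * x₁ + a ^ 2)) + 4 * b * (4 * (x₁ ^ 3 + a * x₁ + b)) ^ 2 - x₁ * (3 * x₁ ^ 4 + 6 * a * x₁ ^ 2 + 12 * b * x₁ - a ^ 2) ^ 2) := by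
    have step : x₃ * ((4 * (x₁ ^ 3 + a * x₁ + b)) * x₁ - (4 * (x₁ ^ 3 + a * x₁ + b) * x₂)) ^ 2 =
        2 * (x₁ * (4 * (x₁ ^ 3 + a * x₁ + b) * x₂) + a * (4 * (x₁ ^ 3 + a * x₁ + b))) * ((4 * (x₁ ^ 3 + a * x₁ + b)) * x₁ + (4 * (x₁ ^ 3 + a * x₁ + b) * x₂)) + 4 * b * (4 * (x₁ ^ 3 + a * x₁ + b)) ^ 2 -
          x₁ * ((4 * (x₁ ^ 3 + a * x₁ + b)) * x₁ - (4 * (x₁ ^ 3 + a * x₁ + b) * x₂)) ^ 2 := by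
      linear_combination (4 * (x₁ ^ 3 + a * x₁ + b)) ^ 2 * hR3
    rw [hR1] at step
    linear_combination step
  -- `Ψ₇(x₁) = 0` from the second duplication relation
  have hΦs : ((x₁ ^ 4 - 2 * a * x₁ ^ 2 - 8 * b * x₁ + a ^ 2) ^ 4 - 2 * a * (x₁ ^ 4 - 2 * a * x₁ ^ 2 - 8 * b * x₁ + a ^ 2) ^ 2 * (4 * (x₁ ^ 3 + a * x₁ + b)) ^ 2 - 8 * b * (x₁ ^ 4 - 2 * a * x₁ ^ 2 - 8 * b * x₁ + a ^ 2) * (4 * (x₁ ^ 3 + a * x₁ + b)) ^ 3 + a ^ 2 * (4 * (x₁ ^ 3 + a * x₁ + b)) ^ 4) * (3 * x₁ ^ 4 + 6 * a * x₁ ^ 2 + 12 * b * x₁ - a ^ 2) ^ 2 - (2 * (x₁ * (x₁ ^ 4 - 2 * a * x₁ ^ 2 - 8 * b * x₁ + a ^ 2) + a * (4 * (x₁ ^ 3 + a * x₁ + b))) * ((4 * (x₁ ^ 3 + a * x₁ + b)) * x₁ + (x₁ ^ 4 - 2 * a * x₁ ^ 2 - 8 * b * x₁ + a ^ 2)) +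 4 * b * (4 * (x₁ ^ 3 + a * x₁ + b)) ^ 2 - x₁ * (3 * x₁ ^ 4 + 6 * a * x₁ ^ 2 + 12 * b * x₁ - a ^ 2) ^ 2) * (4 * (x₁ ^ 3 + a * x₁ + b)) * (4 * ((x₁ ^ 4 - 2 * a * x₁ ^ 2 - 8 * b * x₁ + a ^ 2) ^ 3 + a * (x₁ ^ 4 - 2 * a * x₁ ^ 2 - 8 * b * x₁ + a ^ 2) * (4 * (x₁ ^ 3 + a * x₁ + b)) ^ 2 + b * (4 * (x₁ ^ 3 + a * x₁ + b)) ^ 3)) = 0 := by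
    have step : (4 * (x₁ ^ 3 + a * x₁ + b)) * (4 * ((4 * (x₁ ^ 3 + a * x₁ + b) * x₂) ^ 3 + a * (4 * (x₁ ^ 3 + a * x₁ + b) * x₂) * (4 * (x₁ ^ 3 + a * x₁ + b)) ^ 2 + b * (4 * (x₁ ^ 3 + a * x₁ + b)) ^ 3)) * ((3 * x₁ ^ 4 + 6 * a * x₁ ^ 2 + 12 * b * x₁ - a ^ 2) ^ 2 * x₃) = (3 * x₁ ^ 4 + 6 * a * x₁ ^ 2 + 12 * b * x₁ - a ^ 2) ^ 2 * ((4 * (x₁ ^ 3 + a * x₁ + b) * x₂) ^ 4 - 2 * a * (4 * (x₁ ^ 3 + a * x₁ + b) * x₂) ^ 2 * (4 * (x₁ ^ 3 + a * x₁ + b)) ^ 2 - 8 * b * (4 * (x₁ ^ 3 + a * x₁ + b) * x₂) * (4 * (x₁ ^ 3 + a * x₁ + b)) ^ 3 + a ^ 2 * (4 * (x₁ ^ 3 + a * x₁ + b)) ^ 4) := by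
      linear_combination (4 * (x₁ ^ 3 + a * x₁ + b)) ^ 4 * (3 * x₁ ^ 4 + 6 * a * x₁ ^ 2 + 12 * b * x₁ - a ^ 2) ^ 2 * hR2
    rw [hR1, hR3'] at step
    linear_combination -step
  have hΦ : PolyCert.eval a b x₁ Phi7 = 0 := by
    rw [← hΦs]
    simp only [Phi7, PolyCert.eval_cons, PolyCert.eval_nil, PolyCert.Mono.eval]
    push_cast
    ring
  -- the cleared symmetric functions
  set Dn := ((4 * (x₁ ^ 3 + a * x₁ + b)) * (3 * x₁ ^ 4 + 6 * a * x₁ ^ 2 + 12 * b * x₁ - a ^ 2) ^ 2) with hDn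
  have hDn0 : Dn ≠ 0 := mul_ne_zero hF (pow_ne_zero 2 hΨ3)
  have hs1 : Dn * s₁ = (x₁ * ((4 * (x₁ ^ 3 + a * x₁ + b)) * (3 * x₁ ^ 4 + 6 * a * x₁ ^ 2 + 12 * b * x₁ - a ^ 2) ^ 2) + (x₁ ^ 4 - 2 * a * x₁ ^ 2 - 8 * b * x₁ + a ^ 2) * (3 * x₁ ^ 4 + 6 * a * x₁ ^ 2 + 12 * b * x₁ - a ^ 2) ^ 2 + (2 * (x₁ * (x₁ ^ 4 - 2 * a * x₁ ^ 2 - 8 * b * x₁ + a ^ 2) + a * (4 * (x₁ ^ 3 + a * x₁ + b))) * ((4 * (x₁ ^ 3 + a * x₁ + b)) * x₁ + (x₁ ^ 4 - 2 * a * x₁ ^ 2 - 8 * b * x₁ + a ^ 2)) + 4 * b * (4 * (x₁ ^ 3 + a * x₁ + b)) ^ 2 - x₁ * (3 * x₁ ^ 4 + 6 * a * x₁ ^ 2 + 12 * b * x₁ - a ^ 2) ^ 2) * (4 * (x₁ ^ 3 + a * x₁ + b))) := by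
    have step : Dn * s₁ = x₁ * Dn + (4 * (x₁ ^ 3 + a * x₁ + b) * x₂) * (3 * x₁ ^ 4 + 6 * a * x₁ ^ 2 + 12 * b * x₁ - a ^ 2) ^ 2 + (4 * (x₁ ^ 3 + a * x₁ + b)) * ((3 * x₁ ^ 4 + 6 * a * x₁ ^ 2 + 12 * b * x₁ - a ^ 2) ^ 2 * x₃) := by
      rw [hs₁, hDn]; ring
    rw [hR1, hR3'] at step
    linear_combination step
  have hs2 : Dn * s₂ = (x₁ * (x₁ ^ 4 - 2 * a * x₁ ^ 2 - 8 * b * x₁ + a ^ 2) * (3 * x₁ ^ 4 + 6 * a * x₁ ^ 2 + 12 * b * x₁ - a ^ 2) ^ 2 + x₁ * (2 * (x₁ * (x₁ ^ 4 - 2 * a * x₁ ^ 2 - 8 * b * x₁ + a ^ 2) + a * (4 * (x₁ ^ 3 + a * x₁ + b))) * ((4 * (x₁ ^ 3 + a * x₁ + b)) * x₁ + (x₁ ^ 4 - 2 * a * x₁ ^ 2 - 8 * b * x₁ + a ^ 2)) + 4 * b * (4 * (x₁ ^ 3 + a * x₁ + b)) ^ 2 - x₁ * (3 * x₁ ^ 4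 + 6 * a * x₁ ^ 2 + 12 * b * x₁ - a ^ 2) ^ 2) * (4 * (x₁ ^ 3 + a * x₁ + b)) + (x₁ ^ 4 - 2 * a * x₁ ^ 2 - 8 * b * x₁ + a ^ 2) * (2 * (x₁ * (x₁ ^ 4 - 2 * a * x₁ ^ 2 - 8 * b * x₁ + a ^ 2) + a * (4 * (x₁ ^ 3 + a * x₁ + b))) * ((4 * (x₁ ^ 3 + a * x₁ + b)) * x₁ + (x₁ ^ 4 - 2 * a * x₁ ^ 2 - 8 * b * x₁ + a ^ 2)) + 4 * b * (4 * (x₁ ^ 3 + a * x₁ + b)) ^ 2 - x₁ * (3 * x₁ ^ 4 + 6 * a * x₁ ^ 2 + 12 * b * x₁ - a ^ 2) ^ 2)) := by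
    have step : Dn * s₂ = x₁ * (4 * (x₁ ^ 3 + a * x₁ + b) * x₂) * (3 * x₁ ^ 4 + 6 * a * x₁ ^ 2 + 12 * b * x₁ - a ^ 2) ^ 2 + x₁ * (4 * (x₁ ^ 3 + a * x₁ + b)) * ((3 * x₁ ^ 4 + 6 * a * x₁ ^ 2 + 12 * b * x₁ - a ^ 2) ^ 2 * x₃) + (4 * (x₁ ^ 3 + a * x₁ + b) * x₂) * ((3 * x₁ ^ 4 + 6 * a * x₁ ^ 2 + 12 * b * x₁ - a ^ 2) ^ 2 * x₃) := by
      rw [hs₂, hDn]; ring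
    rw [hR1, hR3'] at step
    linear_combination step
  have hU : PolyCert.eval a b x₁ U7 = 6 * a * Dn ^ 2 + 18 * (x₁ * (x₁ ^ 4 - 2 * a * x₁ ^ 2 - 8 * b * x₁ + a ^ 2) * (3 * x₁ ^ 4 + 6 * a * x₁ ^ 2 + 12 * b * x₁ - a ^ 2) ^ 2 + x₁ * (2 * (x₁ * (x₁ ^ 4 - 2 * a * x₁ ^ 2 - 8 * b * x₁ + a ^ 2) + a * (4 * (x₁ ^ 3 + a * x₁ + b))) * ((4 * (x₁ ^ 3 + a * x₁ + b)) * x₁ + (x₁ ^ 4 - 2 * a * x₁ ^ 2 - 8 * b * x₁ + a ^ 2)) + 4 * b * (4 * (x₁ ^ 3 + a * x₁ + b)) ^ 2 - x₁ * (3 * x₁ ^ 4 + 6 * a * x₁ ^ 2 + 12 * b * x₁ - a ^ 2) ^ 2) * (4 * (x₁ ^ 3 + a * x₁ + b)) + (x₁ ^ 4 - 2 * a * x₁ ^ 2 - 8 * b * x₁ + a ^ 2) * (2 * (x₁ * (x₁ ^ 4 - 2 * a * x₁ ^ 2 - 8 * b * x₁ + a ^ 2) + a * (4 * (x₁ ^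 3 + a * x₁ + b))) * ((4 * (x₁ ^ 3 + a * x₁ + b)) * x₁ + (x₁ ^ 4 - 2 * a * x₁ ^ 2 - 8 * b * x₁ + a ^ 2)) + 4 * b * (4 * (x₁ ^ 3 + a * x₁ + b)) ^ 2 - x₁ * (3 * x₁ ^ 4 + 6 * a * x₁ ^ 2 + 12 * b * x₁ - a ^ 2) ^ 2)) * Dn - 4 * (x₁ * ((4 * (x₁ ^ 3 + a * x₁ + b)) * (3 * x₁ ^ 4 + 6 * a * x₁ ^ 2 + 12 * b * x₁ - a ^ 2) ^ 2) + (x₁ ^ 4 - 2 * a * x₁ ^ 2 - 8 * b * x₁ + a ^ 2) * (3 * x₁ ^ 4 + 6 * a * x₁ ^ 2 + 12 * b * x₁ - a ^ 2) ^ 2 + (2 * (x₁ * (x₁ ^ 4 - 2 * a * x₁ ^ 2 - 8 * b * x₁ + a ^ 2) + a * (4 * (x₁ ^ 3 + a * x₁ + b))) * ((4 * (x₁ ^ 3 + a * x₁ + b)) * x₁ + (x₁ ^ 4 - 2 * a * x₁ ^ 2 - 8 * b * x₁ + a ^ 2)) + 4 * b * (4 * (x₁ ^ 3 + a * x₁ +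 b)) ^ 2 - x₁ * (3 * x₁ ^ 4 + 6 * a * x₁ ^ 2 + 12 * b * x₁ - a ^ 2) ^ 2) * (4 * (x₁ ^ 3 + a * x₁ + b))) ^ 2 := by
    rw [hDn]
    simp only [U7, PolyCert.eval_cons, PolyCert.eval_nil, PolyCert.Mono.eval]
    push_cast
    ring
  have hV : PolyCert.eval a b x₁ V7 = (x₁ * ((4 * (x₁ ^ 3 + a * x₁ + b)) * (3 * x₁ ^ 4 + 6 * a * x₁ ^ 2 + 12 * b * x₁ - a ^ 2) ^ 2) + (x₁ ^ 4 - 2 * a * x₁ ^ 2 - 8 * b * x₁ + a ^ 2) * (3 * x₁ ^ 4 + 6 * a * x₁ ^ 2 + 12 * b * x₁ - a ^ 2) ^ 2 + (2 * (x₁ * (x₁ ^ 4 - 2 * a * x₁ ^ 2 - 8 * b * x₁ + a ^ 2) + a * (4 * (x₁ ^ 3 + a * x₁ + b))) * ((4 * (x₁ ^ 3 + a * x₁ + b)) * x₁ + (x₁ ^ 4 - 2 * a * x₁ ^ 2 - 8 * b * x₁ + a ^ 2)) + 4 * b * (4 * (x₁ ^ 3 + a * x₁ + b)) ^ 2 -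 x₁ * (3 * x₁ ^ 4 + 6 * a * x₁ ^ 2 + 12 * b * x₁ - a ^ 2) ^ 2) * (4 * (x₁ ^ 3 + a * x₁ + b))) ^ 2 - 3 * (x₁ * (x₁ ^ 4 - 2 * a * x₁ ^ 2 - 8 * b * x₁ + a ^ 2) * (3 * x₁ ^ 4 + 6 * a * x₁ ^ 2 + 12 * b * x₁ - a ^ 2) ^ 2 + x₁ * (2 * (x₁ * (x₁ ^ 4 - 2 * a * x₁ ^ 2 - 8 * b * x₁ + a ^ 2) + a * (4 * (x₁ ^ 3 + a * x₁ + b))) * ((4 * (x₁ ^ 3 + a * x₁ + b)) * x₁ + (x₁ ^ 4 - 2 * a * x₁ ^ 2 - 8 * b * x₁ + a ^ 2)) + 4 * b * (4 * (x₁ ^ 3 + a * x₁ + b)) ^ 2 - x₁ * (3 * x₁ ^ 4 + 6 * a * x₁ ^ 2 + 12 * b * x₁ - a ^ 2) ^ 2) * (4 * (x₁ ^ 3 + a * x₁ + b)) + (x₁ ^ 4 - 2 * a * x₁ ^ 2 - 8 * b * x₁ + a ^ 2) * (2 * (x₁ * (x₁ ^ 4 - 2 * a * x₁ ^ 2 -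 8 * b * x₁ + a ^ 2) + a * (4 * (x₁ ^ 3 + a * x₁ + b))) * ((4 * (x₁ ^ 3 + a * x₁ + b)) * x₁ + (x₁ ^ 4 - 2 * a * x₁ ^ 2 - 8 * b * x₁ + a ^ 2)) + 4 * b * (4 * (x₁ ^ 3 + a * x₁ + b)) ^ 2 - x₁ * (3 * x₁ ^ 4 + 6 * a * x₁ ^ 2 + 12 * b * x₁ - a ^ 2) ^ 2)) * Dn := by
    rw [hDn]
    simp only [V7, PolyCert.eval_cons, PolyCert.eval_nil, PolyCert.Mono.eval]
    push_cast
    ring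
  have hUb : PolyCert.eval a b x₁ U7b = (x₁ * ((4 * (x₁ ^ 3 + a * x₁ + b)) * (3 * x₁ ^ 4 + 6 * a * x₁ ^ 2 + 12 * b * x₁ - a ^ 2) ^ 2) + (x₁ ^ 4 - 2 * a * x₁ ^ 2 - 8 * b * x₁ + a ^ 2) * (3 * x₁ ^ 4 + 6 * a * x₁ ^ 2 + 12 * b * x₁ - a ^ 2) ^ 2 + (2 * (x₁ * (x₁ ^ 4 - 2 * a * x₁ ^ 2 - 8 * b * x₁ + a ^ 2) + a * (4 * (x₁ ^ 3 + a * x₁ + b))) * ((4 * (x₁ ^ 3 + a * x₁ + b)) * x₁ + (x₁ ^ 4 - 2 * a * x₁ ^ 2 - 8 * b * x₁ + a ^ 2)) + 4 * b * (4 * (x₁ ^ 3 + a * x₁ + b)) ^ 2 - x₁ * (3 * x₁ ^ 4 + 6 * a * x₁ ^ 2 + 12 * b * x₁ - a ^ 2) ^ 2) * (4 * (x₁ ^ 3 + a * x₁ + b))) ^ 2 - 5 * (x₁ * (x₁ ^ 4 - 2 * a * x₁ ^ 2 - 8 * b * x₁ + a ^ 2) * (3 * x₁ ^ 4 + 6 *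 a * x₁ ^ 2 + 12 * b * x₁ - a ^ 2) ^ 2 + x₁ * (2 * (x₁ * (x₁ ^ 4 - 2 * a * x₁ ^ 2 - 8 * b * x₁ + a ^ 2) + a * (4 * (x₁ ^ 3 + a * x₁ + b))) * ((4 * (x₁ ^ 3 + a * x₁ + b)) * x₁ + (x₁ ^ 4 - 2 * a * x₁ ^ 2 - 8 * b * x₁ + a ^ 2)) + 4 * b * (4 * (x₁ ^ 3 + a * x₁ + b)) ^ 2 - x₁ * (3 * x₁ ^ 4 + 6 * a * x₁ ^ 2 + 12 * b * x₁ - a ^ 2) ^ 2) * (4 * (x₁ ^ 3 + a * x₁ + b)) + (x₁ ^ 4 - 2 * a * x₁ ^ 2 - 8 * b * x₁ + a ^ 2) * (2 * (x₁ * (x₁ ^ 4 - 2 * a * x₁ ^ 2 - 8 * b * x₁ + a ^ 2) + a * (4 * (x₁ ^ 3 + a * x₁ + b))) * ((4 * (x₁ ^ 3 + a * x₁ + b)) * x₁ + (x₁ ^ 4 - 2 * a * x₁ ^ 2 - 8 * b * x₁ + a ^ 2)) + 4 * b * (4 * (x₁ ^ 3 + a * x₁ + b)) ^ 2 - x₁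 * (3 * x₁ ^ 4 + 6 * a * x₁ ^ 2 + 12 * b * x₁ - a ^ 2) ^ 2)) * Dn - 18 * a * Dn ^ 2 := by
    rw [hDn]
    simp only [U7b, PolyCert.eval_cons, PolyCert.eval_nil, PolyCert.Mono.eval]
    push_cast
    ring
  have hVb : PolyCert.eval a b x₁ V7b = 2 * ((x₁ * (x₁ ^ 4 - 2 * a * x₁ ^ 2 - 8 * b * x₁ + a ^ 2) * (3 * x₁ ^ 4 + 6 * a * x₁ ^ 2 + 12 * b * x₁ - a ^ 2) ^ 2 + x₁ * (2 * (x₁ * (x₁ ^ 4 - 2 * a * x₁ ^ 2 - 8 * b * x₁ + a ^ 2) + a * (4 * (x₁ ^ 3 + a * x₁ + b))) * ((4 * (x₁ ^ 3 + a * x₁ + b)) * x₁ + (x₁ ^ 4 - 2 * a * x₁ ^ 2 - 8 * b * x₁ + a ^ 2)) + 4 * b * (4 * (x₁ ^ 3 + a * x₁ + b)) ^ 2 - x₁ * (3 * x₁ ^ 4 + 6 * a * x₁ ^ 2 + 12 * b * x₁ - a ^ 2) ^ 2) * (4 * (x₁ ^ 3 + a * x₁ + b)) + (x₁ ^ 4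 - 2 * a * x₁ ^ 2 - 8 * b * x₁ + a ^ 2) * (2 * (x₁ * (x₁ ^ 4 - 2 * a * x₁ ^ 2 - 8 * b * x₁ + a ^ 2) + a * (4 * (x₁ ^ 3 + a * x₁ + b))) * ((4 * (x₁ ^ 3 + a * x₁ + b)) * x₁ + (x₁ ^ 4 - 2 * a * x₁ ^ 2 - 8 * b * x₁ + a ^ 2)) + 4 * b * (4 * (x₁ ^ 3 + a * x₁ + b)) ^ 2 - x₁ * (3 * x₁ ^ 4 + 6 * a * x₁ ^ 2 + 12 * b * x₁ - a ^ 2) ^ 2)) * Dn + a * Dn ^ 2) := by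
    rw [hDn]
    simp only [V7b, PolyCert.eval_cons, PolyCert.eval_nil, PolyCert.Mono.eval]
    push_cast
    ring
  -- the two certified identities, evaluated (kernel-checked certificates of
  -- `KleinFrickeSevenCertificateKernel`; formerly `eval_eq_of_isZero_sub _ _ _ gamma7_cert` /
  -- `gamma7b_cert`, which depend on `native_decide`)
  have k1 := PolyCert.eval_gamma7Of_eq_kernel a b x₁
  have k2 := PolyCert.eval_gamma7bOf_eq_kernel a b x₁
  rw [PolyCert.eval_mul, hΦ, mul_zero, eval_gamma7Of] at k1 k2
  rw [hU, hV, ← hs1, ← hs2] at k1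
  rw [hUb, hVb, ← hs1, ← hs2] at k2
  generalize Dn = D at k1 k2 hDn0
  have hD16 : D ^ 16 ≠ 0 := pow_ne_zero 16 hDn0
  constructor
  · apply mul_left_cancel₀ hD16
    linear_combination k1
  · apply mul_left_cancel₀ hD16
    linear_combination k2

end Literature.NumberTheory.EllipticCurves

namespace WeierstrassCurve

open Literature.NumberTheory.EllipticCurves

/-- From the cleared identity `6912a³·u·v⁷ = (4a³+27b²)(u²+13uv+49v²)(u²+5uv+v²)³` (`v ≠ 0`,
`4a³ + 27b² ≠ 0`) to Fricke's form at level `7` with `t = u/v ≠ 0`. [folklore] -/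
theorem klein_seven_of_cleared {L : Type*} [Field L] [CharZero L] {a b u v : L} (hv : v ≠ 0)
    (hdisc : 4 * a ^ 3 + 27 * b ^ 2 ≠ 0)
    (hG : 6912 * a ^ 3 * u * v ^ 7 =
      (4 * a ^ 3 + 27 * b ^ 2) * (u ^ 2 + 13 * (u * v) + 49 * v ^ 2) *
        (u ^ 2 + 5 * (u * v) + v ^ 2) ^ 3) :
    u / v ≠ 0 ∧ 6912 * a ^ 3 / (4 * a ^ 3 + 27 * b ^ 2) =
      ((u / v) ^ 2 + 13 * (u / v) + 49) * ((u / v) ^ 2 + 5 * (u / v) + 1) ^ 3 / (u / v) := by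
  have hu : u ≠ 0 := by
    rintro rfl
    have : (4 * a ^ 3 + 27 * b ^ 2) * (49 * v ^ 8) = 0 := by linear_combination -hG
    rcases mul_eq_zero.mp this with h | h
    · exact hdisc h
    · exact hv (by simpa using h)
  refine ⟨div_ne_zero hu hv, ?_⟩
  rw [eq_div_iff (div_ne_zero hu hv), div_mul_eq_mul_div, div_eq_iff hdisc]
  field_simp
  linear_combination hG

/-- If the cleared identity holds with `v = 0` then `u = 0`. [folklore] -/
theorem klein_seven_u_eq_zero {L : Type*} [Field L] [CharZero L] {a b u : L}
    (hdisc : 4 * a ^ 3 + 27 * b ^ 2 ≠ 0)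
    (hG : 6912 * a ^ 3 * u * (0 : L) ^ 7 =
      (4 * a ^ 3 + 27 * b ^ 2) * (u ^ 2 + 13 * (u * 0) + 49 * (0 : L) ^ 2) *
        (u ^ 2 + 5 * (u * 0) + (0 : L) ^ 2) ^ 3) : u = 0 := by
  have : (4 * a ^ 3 + 27 * b ^ 2) * u ^ 8 = 0 := by linear_combination -hG
  rcases mul_eq_zero.mp this with h | h
  · exact (hdisc h).elim
  · exact pow_eq_zero_iff (by norm_num) |>.mp h

variable {K : Type u} [Field K] [CharZero K]

set_option maxHeartbeats 800000 in
/-- **Klein–Fricke at level `7` (short normal form, `j ≠ 0`).** A short Weierstrass elliptic curve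
`y² = x³ + ax + b` with `a ≠ 0` over a field of characteristic `0` admitting a rational isogeny of
degree `7` has `j = (t² + 13t + 49)(t² + 5t + 1)³ / t` for some nonzero `t ∈ K`: `t = U/V` for one of
the two formulae of `klein_seven_core` (both cannot degenerate unless `a = 0`).
[cite: SilvermanAEC2009, III.2.3, III.4.12] -/
theorem Isogeny.exists_j_eq_klein_seven_of_isShortNF {V V' : WeierstrassCurve K} [V.IsShortNF]
    [V.IsElliptic] (φ : Isogeny V V') (hdeg : φ.degree = 7) (ha : V.a₄ ≠ 0) :
    ∃ t : K, t ≠ 0 ∧ V.j = (t ^ 2 + 13 * t + 49) * (t ^ 2 + 5 * t + 1) ^ 3 / t := by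
  obtain ⟨x₁, x₂, x₃, s₀, p₀, hs, hp, hx, hf₁, -, hR1, hR2, hR3⟩ :=
    φ.exists_kernel_coords_of_degree_eq_seven hdeg
  set ι := algebraMap K (AlgebraicClosure K) with hι
  have hdisc : 4 * V.a₄ ^ 3 + 27 * V.a₆ ^ 2 ≠ 0 := by
    have hΔ : V.Δ ≠ 0 := by rw [← coe_Δ']; exact V.Δ'.ne_zero
    rw [V.Δ_of_isShortNF] at hΔ
    intro h; apply hΔ; linear_combination (-16) * h
  obtain ⟨k1, k2⟩ := klein_seven_core hf₁ hx hR1 hR2 hR3 (ι s₀) (ι p₀) hs hp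
  -- pull the two identities back to `K`
  have hinj := (algebraMap K (AlgebraicClosure K)).injective
  set U₁ : K := 6 * V.a₄ + 18 * p₀ - 4 * s₀ ^ 2 with hU₁
  set V₁ : K := s₀ ^ 2 - 3 * p₀ with hV₁
  set U₂ : K := s₀ ^ 2 - 5 * p₀ - 18 * V.a₄ with hU₂
  set V₂ : K := 2 * (p₀ + V.a₄) with hV₂
  have k1K : 6912 * V.a₄ ^ 3 * U₁ * V₁ ^ 7 = (4 * V.a₄ ^ 3 + 27 * V.a₆ ^ 2) *
      (U₁ ^ 2 + 13 * (U₁ * V₁) + 49 * V₁ ^ 2) * (U₁ ^ 2 + 5 * (U₁ * V₁) + V₁ ^ 2) ^ 3 := by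
    apply hinj
    simp only [map_mul, map_add, map_sub, map_pow, map_ofNat, hU₁, hV₁, ← hι]
    exact k1
  have k2K : 6912 * V.a₄ ^ 3 * U₂ * V₂ ^ 7 = (4 * V.a₄ ^ 3 + 27 * V.a₆ ^ 2) *
      (U₂ ^ 2 + 13 * (U₂ * V₂) + 49 * V₂ ^ 2) * (U₂ ^ 2 + 5 * (U₂ * V₂) + V₂ ^ 2) ^ 3 := by
    apply hinj
    simp only [map_mul, map_add, map_sub, map_pow, map_ofNat, hU₂, hV₂, ← hι]
    exact k2
  by_cases hV₁0 : V₁ ≠ 0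
  · obtain ⟨ht, hj⟩ := klein_seven_of_cleared hV₁0 hdisc k1K
    exact ⟨U₁ / V₁, ht, by rw [V.j_of_isShortNF]; exact hj⟩
  · rw [not_ne_iff] at hV₁0
    rw [hV₁0] at k1K
    have hU₁0 : U₁ = 0 := klein_seven_u_eq_zero hdisc k1K
    by_cases hV₂0 : V₂ ≠ 0
    · obtain ⟨ht, hj⟩ := klein_seven_of_cleared hV₂0 hdisc k2K
      exact ⟨U₂ / V₂, ht, by rw [V.j_of_isShortNF]; exact hj⟩
    · rw [not_ne_iff] at hV₂0
      rw [hV₂0] at k2K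
      have hU₂0 : U₂ = 0 := klein_seven_u_eq_zero hdisc k2K
      exfalso
      apply ha
      rw [hU₁] at hU₁0; rw [hV₁] at hV₁0; rw [hU₂] at hU₂0; rw [hV₂] at hV₂0
      linear_combination (-1 / 16 : K) * hU₂0 + (1 / 16 : K) * hV₁0 + (-1 / 16 : K) * hV₂0

/-- **Klein–Fricke at level `7`.** If an elliptic curve over a field `K` of characteristic zero
with `j ≠ 0` admits a `K`-rational isogeny of degree `7`, then
`j = (t² + 13t + 49)(t² + 5t + 1)³ / t` for some nonzero `t ∈ K` (Fricke's Hauptmodul relation for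
`X₀(7)`; Klein–Fricke 1892; Maier 2009, Table 4; used in Kenku 1982, proof of Thm 1, case (c),
`N' = 7`). The excluded `j = 0` is a genuine exception to the rational formula for `t` used here
(the CM `7`-isogenies of `y² = x³ + b` over `ℚ(√-3)` have `t² + 13t + 49 = 0`).
[cite: SilvermanAEC2009, III.1.4(b), III.2.3, III.4.12] -/
theorem Isogeny.exists_j_eq_klein_seven_of_degree_eq_seven {W W' : WeierstrassCurve K}
    [W.IsElliptic] (φ : Isogeny W W') (hdeg : φ.degree = 7) (hj0 : W.j ≠ 0) :
    ∃ t : K, t ≠ 0 ∧ W.j = (t ^ 2 + 13 * t + 49) * (t ^ 2 + 5 * t + 1) ^ 3 / t := by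
  haveI : Invertible (2 : K) := invertibleOfNonzero two_ne_zero
  haveI : Invertible (3 : K) := invertibleOfNonzero three_ne_zero
  obtain ⟨C, hC⟩ := W.exists_variableChange_isShortNF
  obtain ⟨ψ, hψ⟩ := φ.exists_degree_eq_of_variableChange C
  have ha : (C • W).a₄ ≠ 0 := by
    intro h0
    apply hj0
    rw [← variableChange_j W C, (C • W).j_of_isShortNF, h0]
    simp
  obtain ⟨t, ht, hj⟩ := ψ.exists_j_eq_klein_seven_of_isShortNF (hψ.trans hdeg) ha
  exact ⟨t, ht, by rwa [variableChange_j] at hj⟩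

end WeierstrassCurve

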